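import Mathlib
import Summits.PneNP.PneNP.Theorems.ClusUniversalCertificateCoordGauge

/-!
# Route ClusUniversalCertificate, crux `UniversalCertAll` — path `coord`: the THRESHOLD FAMILY is a block layer family

Support file for `stmt-PneNP-19683` (cell pnp-ideate, route `ClusUniversalCertificate`, rung F-N1; path `coord` of pnp-ideate-p1, skeleton v13
sha16 c4824afb; ask H3 of p1 g7, STATUS 11:52Z; objects of record `…CoordDefs.lean` p516754 / `…CoordBlkDefs.lean` p519312, namespace
`…Theorems.ClusCoord`).  THRESHOLDS: for a block `k` (deleted along `π = delBlk`, `kemb` data `(M', h)`) and `t < 2^{bsize k}` put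
`T_t := {x : t < f(x)}`, `f(x) = #{y ∈ Y : π y = x}` the fibre multiplicity.  Since a fibre of `π` is contained in a coset of `ker π` and
`finrank (ker π) = bsize k` (`card_fibre_le`: `f(x) ≤ 2^{bsize k}`), every `x` lies in exactly `#{t < 2^{bsize k} : t < f(x)} = f(x)` thresholds:
the list `thresholds = [T_0, …, T_{2^{bsize k} − 1}]` is a block layer family (`isBLayerFamily_thresholds`).  So «thresholds satisfy `BLayerIneq`
⇒ the block step» is a one-liner with the landed `ClusCoord.stub_cBookBlk` (`peelBlock_of_thresholds`).
FRONTIER rung F-N1; bookkeeping — the conjecture and the crux are OPEN; nothing here bears on P vs NP.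
-/

set_option linter.dupNamespace false -- `Summit.PneNP.PneNP.…`: summit = sub-problem name (D-0017 single-conjunct layout)

namespace Summit.PneNP.PneNP.Theorems.ClusCoordThresholds

open Finset
open Summit.PneNP.PneNP.Theorems.ClusCoord (bsize zcount kemb IsBLayerFamily BLayerIneq)
open Summit.PneNP.PneNP.Theorems.ClusCoordBookBlk (blk_kemb_ne exists_kemb_eq)
open Summit.PneNP.PneNP.Theorems.ClusCoordZeroFree (blockProj blockProj_apply sum_bsize_eq)
open Summit.PneNP.PneNP.Theorems.ClusCoordGauge (delBlk delBlk_apply eq_zero_of_blockProj_of_delBlk)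

variable {M M' n : ℕ}

/-! ## The fibre multiplicity and the thresholds -/

/-- The fibre multiplicity `f(x) = #{y ∈ Y : π y = x}`. -/
noncomputable def fibre (blk : Fin M → Fin n) (Y : Finset (Fin M → ZMod 2)) (k : Fin n) (M' : ℕ)
    (h : (univ.filter fun i => blk i ≠ k).card = M') (x : Fin M' → ZMod 2) : ℕ :=
  (Y.filter fun y => (fun j => y (kemb blk k M' h j)) = x).card

/-- The threshold `T_t = {x : t < f(x)}`. -/
noncomputable def threshold (blk : Fin M → Fin n) (Y : Finset (Fin M → ZMod 2)) (k : Fin n) (M' : ℕ)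
    (h : (univ.filter fun i => blk i ≠ k).card = M') (t : ℕ) : Finset (Fin M' → ZMod 2) :=
  univ.filter fun x => t < fibre blk Y k M' h x

/-- The THRESHOLD FAMILY `[T_0, …, T_{2^{bsize k} − 1}]`. -/
noncomputable def thresholds (blk : Fin M → Fin n) (Y : Finset (Fin M → ZMod 2)) (k : Fin n) (M' : ℕ)
    (h : (univ.filter fun i => blk i ≠ k).card = M') : List (Finset (Fin M' → ZMod 2)) :=
  (List.range (2 ^ bsize blk k)).map (threshold blk Y k M' h)

/-! ## Fibres have at most `2^{bsize k}` points -/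

/-- The deletion of block `k` is onto. -/
theorem delBlk_surjective (blk : Fin M → Fin n) (k : Fin n) (h : (univ.filter fun i => blk i ≠ k).card = M') :
    Function.Surjective (delBlk blk k M' h) := by
  intro x
  classical
  -- lift `x` by zero on block `k`
  refine ⟨fun i => if hi : blk i ≠ k then x (Classical.choose (exists_kemb_eq blk k h i hi)) else 0, ?_⟩
  funext l
  rw [delBlk_apply]
  have hl : blk (kemb blk k M' h l) ≠ k := blk_kemb_ne blk k h l
  simp only [hl, ne_eq, not_false_eq_true, dif_pos]
  congr 1
  exact (kemb blk k M' h).injective (Classical.choose_spec (exists_kemb_eq blk k h _ hl))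

/-- `finrank (ker π) = bsize k`. -/
theorem finrank_ker_delBlk (blk : Fin M → Fin n) (k : Fin n) (h : (univ.filter fun i => blk i ≠ k).card = M') :
    Module.finrank (ZMod 2) (LinearMap.ker (delBlk blk k M' h)) = bsize blk k := by
  have hrn := LinearMap.finrank_range_add_finrank_ker (delBlk blk k M' h)
  rw [LinearMap.range_eq_top.mpr (delBlk_surjective blk k h), finrank_top, Module.finrank_fintype_fun_eq_card,
    Module.finrank_fintype_fun_eq_card, Fintype.card_fin, Fintype.card_fin] at hrn
  -- `M = M' + bsize k`
  have hM : M' + bsize blk k = M := by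
    have h1 := Finset.card_filter_add_card_filter_not (s := (univ : Finset (Fin M))) (fun i => blk i ≠ k)
    rw [Finset.card_univ, Fintype.card_fin, h] at h1
    have h2 : (univ.filter fun i : Fin M => ¬ blk i ≠ k) = univ.filter fun i => blk i = k :=
      Finset.filter_congr fun i _ => not_ne_iff
    rw [h2] at h1
    exact h1
  unfold bsize at hM ⊢
  omega

/-- **A fibre of the block deletion has at most `2^{bsize k}` points** (it lies in a coset of `ker π`). -/
theorem card_fibre_le (blk : Fin M → Fin n) (Y : Finset (Fin M → ZMod 2)) (k : Fin n) (M' : ℕ)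
    (h : (univ.filter fun i => blk i ≠ k).card = M') (x : Fin M' → ZMod 2) :
    fibre blk Y k M' h x ≤ 2 ^ bsize blk k := by
  classical
  unfold fibre
  by_cases hx : ∃ y₀ ∈ Y, (fun j => y₀ (kemb blk k M' h j)) = x
  · obtain ⟨y₀, -, hy₀⟩ := hx
    set K := LinearMap.ker (delBlk blk k M' h) with hK
    let f : K ↪ (Fin M → ZMod 2) := ⟨fun d => (d : Fin M → ZMod 2) + y₀, fun a b hab => Subtype.ext (add_right_cancel hab)⟩
    have hsub : (Y.filter fun y => (fun j => y (kemb blk k M' h j)) = x) ⊆ (univ : Finset K).map f := by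
      intro y hy
      rw [Finset.mem_map]
      have hyx := (Finset.mem_filter.1 hy).2
      have hd : y - y₀ ∈ K := by
        rw [hK, LinearMap.mem_ker, map_sub, sub_eq_zero]
        change (fun j => y (kemb blk k M' h j)) = fun j => y₀ (kemb blk k M' h j)
        rw [hyx, hy₀]
      exact ⟨⟨y - y₀, hd⟩, Finset.mem_univ _, by change (y - y₀) + y₀ = y; rw [sub_add_cancel]⟩
    calc (Y.filter fun y => (fun j => y (kemb blk k M' h j)) = x).card ≤ ((univ : Finset K).map f).card :=
          Finset.card_le_card hsub
      _ = 2 ^ bsize blk k := by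
          rw [Finset.card_map, Finset.card_univ, Module.card_eq_pow_finrank (K := ZMod 2), ZMod.card, finrank_ker_delBlk]
  · have : (Y.filter fun y => (fun j => y (kemb blk k M' h j)) = x) = ∅ := by
      rw [Finset.filter_eq_empty_iff]
      intro y hy hyx
      exact hx ⟨y, hy, hyx⟩
    rw [this, Finset.card_empty]
    positivity

/-! ## The threshold family is a block layer family -/

/-- Counting the small numbers below a bound inside `List.range`. -/
theorem length_filter_range_lt (m N : ℕ) (hm : m ≤ N) :
    ((List.range N).filter fun t => decide (t < m)).length = m := by
  induction N with
  | zero =>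
    have : m = 0 := Nat.le_zero.mp hm
    subst this
    simp
  | succ N ih =>
    rw [List.range_succ, List.filter_append, List.length_append]
    rcases Nat.lt_or_ge N m with hlt | hge
    · -- then `m = N + 1`
      have hmN : m = N + 1 := le_antisymm hm hlt
      subst hmN
      have h1 : ((List.range N).filter fun t => decide (t < N + 1)).length = N := by
        rw [List.filter_eq_self.mpr, List.length_range]
        intro t ht
        have := List.mem_range.mp ht
        simpa using Nat.lt_succ_of_lt this
      rw [h1]
      simp
    · rw [ih hge]
      simp [Nat.not_lt.mpr hge]

/-- **The threshold family is a block layer family**: every `x` lies in exactly `f(x)` thresholds. -/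
theorem isBLayerFamily_thresholds (blk : Fin M → Fin n) (Y : Finset (Fin M → ZMod 2)) (k : Fin n) (M' : ℕ)
    (h : (univ.filter fun i => blk i ≠ k).card = M') : IsBLayerFamily blk Y k M' h (thresholds blk Y k M' h) := by
  intro x
  unfold thresholds
  rw [List.filter_map, List.length_map]
  have hcomp : ((fun S : Finset (Fin M' → ZMod 2) => decide (x ∈ S)) ∘ threshold blk Y k M' h) =
      fun t => decide (t < fibre blk Y k M' h x) := by
    funext t
    simp [threshold]
  rw [hcomp, length_filter_range_lt _ _ (card_fibre_le blk Y k M' h x)]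
  rfl

/-- Hence: if the thresholds of block `k` satisfy the block layer inequality, the block disjunct of the peel conjecture holds for
`(Y, k)` (and the landed `ClusCoord.stub_cBookBlk` transfers the members' certificates). -/
theorem peelBlock_of_thresholds (blk : Fin M → Fin n) (Y : Finset (Fin M → ZMod 2)) (k : Fin n) (M' : ℕ)
    (h : (univ.filter fun i => blk i ≠ k).card = M') (hineq : BLayerIneq M n blk Y k M' (thresholds blk Y k M' h)) :
    ∃ L : List (Finset (Fin M' → ZMod 2)), IsBLayerFamily blk Y k M' h L ∧ BLayerIneq M n blk Y k M' L :=
  ⟨thresholds blk Y k M' h, isBLayerFamily_thresholds blk Y k M' h, hineq⟩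

/-! ## Size-1 blocks: the threshold family is `[support, double fibres]` and `BLayerIneq` reads as p1's T1 -/

/-- For a block of size `1` the threshold family has exactly two members, `T_0` (the support of the projection) and `T_1` (the
points with a double fibre). -/
theorem thresholds_of_bsize_one (blk : Fin M → Fin n) (Y : Finset (Fin M → ZMod 2)) (k : Fin n) (M' : ℕ)
    (h : (univ.filter fun i => blk i ≠ k).card = M') (hb : bsize blk k = 1) :
    thresholds blk Y k M' h = [threshold blk Y k M' h 0, threshold blk Y k M' h 1] := by
  unfold thresholds
  rw [hb]
  rfl

/-- For a block of size `1` the block layer inequality of the thresholds is p1's **T1** shape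
`D(Y) ≤ D(T_0) + D(T_1) + 2·Z_k(Y)` (`T_0 = X₀ ∪ X₁`, `T_1 = X₀ ∩ X₁`, `Z_k = |X₀|` in the two-slice picture). -/
theorem bLayerIneq_thresholds_iff_of_bsize_one (blk : Fin M → Fin n) (Y : Finset (Fin M → ZMod 2)) (k : Fin n) (M' : ℕ)
    (h : (univ.filter fun i => blk i ≠ k).card = M') (hb : bsize blk k = 1) :
    BLayerIneq M n blk Y k M' (thresholds blk Y k M' h) ↔
      Summit.PneNP.PneNP.Theorems.ClusCoord.dsum M Y ≤
        Summit.PneNP.PneNP.Theorems.ClusCoord.dsum M' (threshold blk Y k M' h 0) +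
          Summit.PneNP.PneNP.Theorems.ClusCoord.dsum M' (threshold blk Y k M' h 1) + 2 * (zcount blk k Y : ℤ) := by
  unfold BLayerIneq
  rw [thresholds_of_bsize_one blk Y k M' h hb, hb]
  simp only [List.map_cons, List.map_nil, List.sum_cons, List.sum_nil, add_zero, Nat.cast_one, sub_self, zero_mul,
    pow_one]

/-- Hence, along a size-1 block, p1's T1 inequality for the thresholds gives the block disjunct of the peel conjecture. -/
theorem peelBlock_of_T1 (blk : Fin M → Fin n) (Y : Finset (Fin M → ZMod 2)) (k : Fin n) (M' : ℕ)
    (h : (univ.filter fun i => blk i ≠ k).card = M') (hb : bsize blk k = 1)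
    (hT1 : Summit.PneNP.PneNP.Theorems.ClusCoord.dsum M Y ≤
      Summit.PneNP.PneNP.Theorems.ClusCoord.dsum M' (threshold blk Y k M' h 0) +
        Summit.PneNP.PneNP.Theorems.ClusCoord.dsum M' (threshold blk Y k M' h 1) + 2 * (zcount blk k Y : ℤ)) :
    ∃ L : List (Finset (Fin M' → ZMod 2)), IsBLayerFamily blk Y k M' h L ∧ BLayerIneq M n blk Y k M' L :=
  peelBlock_of_thresholds blk Y k M' h ((bLayerIneq_thresholds_iff_of_bsize_one blk Y k M' h hb).mpr hT1)

end Summit.PneNP.PneNP.Theorems.ClusCoordThresholds
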